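import Literature.AlgebraicGeometry.Resolution.LogRefinedChartUnits
import Mathlib.LinearAlgebra.Dimension.OrzechProperty
import Mathlib.LinearAlgebra.FreeModule.PID
import HarnessLib

/-!
# Crux `FrobeniusLadder.FRationalResolution` (stmt-ResolutionOfSingularities-15317), line `redirect`,
# stub `stub_diagonalizableQuotientResolution` — a spanning monoid generated modulo a sublattice by `rank`-many elements is
# ORTHANT-LIKE after localizing at that sublattice (brick (ι′): the adapter from Kato's regularity criterion to the
# cosupport condition of brick T1)

`…KatoRegularityCriterion` (`LogChart.exists_generators_mod_faceMonoid_of_isRegularLocalRing`) concludes, at a regular point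
of a log regular chart, that `P` is generated modulo `ℤ F` by a finite `Q` with `#Q ≤ n − rk ℤF`. This file turns that into
the shape consumed by the Kato pipeline (`LogRefinedChart.IsOrthantLike`): **if `P ⊆ ℤⁿ` spans `ℤⁿ`, `M ⊆ ℤⁿ` is a subgroup,
`Q ⊆ P` has `#Q ≤ n − rk M`, and every `p ∈ P` is an `ℕ`-combination of `Q` modulo `M`, then `P + M = ℕ^I ⊕ ℤ^{Iᶜ}` in a
`ℤ`-basis of `ℤⁿ`** (the basis: `Q` together with a `ℤ`-basis of `M` — `n` vectors spanning `ℤⁿ`, a basis by the Orzech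
property; `I` = the `Q`-coordinates). In Kato's terms: `M̄ = (P + F^{gp})/F^{gp} ≅ ℕ^r`, i.e. the face `F^⊥ ∩ P^∨` is regular.

* `isOrthantLike_sup_of_generators_mod` — the statement above.

Honest label: lattice algebra (no stub closed). No definitions, no named facts, no sorry.
[cite: Kato1994, (9.8), (10.4)] [cite: Fulton1993Toric, §2.1]
-/

noncomputable section

-- single-problem summit: the doubled namespace component is forced
set_option linter.dupNamespace false

namespace Summit.ResolutionOfSingularities.ResolutionOfSingularities.Theorems.FRationalResolution.OrthantLikeOfGenerators

open Literature.AlgebraicGeometry.Resolution Literature.AlgebraicGeometry.Resolution.LogRefinedChart Module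

/-- **Generated modulo `M` by `n − rk M` elements ⇒ orthant-like.** Let `P ⊆ ℤⁿ` be a submonoid spanning `ℤⁿ`, `M ⊆ ℤⁿ` a
subgroup, `Q ⊆ P` finite with `#Q ≤ n − rk_ℤ M` such that every `p ∈ P` is congruent modulo `M` to an `ℕ`-combination of `Q`.
Then there are a `ℤ`-basis `b` of `ℤⁿ` and `I` with `P + M = {x : b^*_i(x) ≥ 0 ∀ i ∈ I}`. [cite: Kato1994, (9.8)] -/
theorem isOrthantLike_sup_of_generators_mod {n : ℕ} (P : AddSubmonoid (Fin n → ℤ))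
    (hspan : Submodule.span ℤ (P : Set (Fin n → ℤ)) = ⊤) (M : Submodule ℤ (Fin n → ℤ))
    (Q : Finset (Fin n → ℤ)) (hQP : ∀ q ∈ Q, q ∈ P) (hcard : Q.card ≤ n - finrank ℤ M)
    (hgen : ∀ p ∈ P, ∃ c : (Fin n → ℤ) → ℕ, p - ∑ q ∈ Q, c q • q ∈ M) :
    ∃ (b : Basis (Fin n) ℤ (Fin n → ℤ)) (I : Finset (Fin n)), IsOrthantLike b I (P ⊔ M.toAddSubmonoid) := by
  classical
  -- a `ℤ`-basis of `M`
  obtain ⟨m, fM⟩ := Submodule.basisOfPid (Pi.basisFun ℤ (Fin n)) M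
  have hm : finrank ℤ M = m := by rw [finrank_eq_card_basis fM, Fintype.card_fin]
  have hmn : m ≤ n := by
    rw [← hm]
    have := Submodule.finrank_le M
    rwa [finrank_fin_fun] at this
  -- the candidate basis: `Q` and the basis of `M`
  let e : ↥Q ⊕ Fin m → (Fin n → ℤ) := Sum.elim (fun q => (q : Fin n → ℤ)) (fun j => (fM j : Fin n → ℤ))
  have hM_le : (M : Set (Fin n → ℤ)) ⊆ Submodule.span ℤ (Set.range e) := by
    intro x hx
    have hx' : (⟨x, hx⟩ : M) = ∑ j, fM.repr ⟨x, hx⟩ j • fM j := (fM.sum_repr ⟨x, hx⟩).symm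
    have hx'' : x = ∑ j, fM.repr ⟨x, hx⟩ j • (fM j : Fin n → ℤ) := by
      have h := congrArg (fun y : M => (y : Fin n → ℤ)) hx'
      simp only [Submodule.coe_sum, Submodule.coe_smul] at h
      exact h
    rw [hx'']
    exact Submodule.sum_mem _ fun j _ => Submodule.smul_mem _ _ (Submodule.subset_span ⟨Sum.inr j, rfl⟩)
  have hP_le : (P : Set (Fin n → ℤ)) ⊆ Submodule.span ℤ (Set.range e) := by
    intro p hp
    obtain ⟨c, hc⟩ := hgen p hp
    have h1 : ∑ q ∈ Q, c q • q ∈ Submodule.span ℤ (Set.range e) := by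
      refine Submodule.sum_mem _ fun q hq => ?_
      rw [← natCast_zsmul]
      exact Submodule.smul_mem _ _ (Submodule.subset_span ⟨Sum.inl ⟨q, hq⟩, rfl⟩)
    have h2 := hM_le hc
    have : p = (p - ∑ q ∈ Q, c q • q) + ∑ q ∈ Q, c q • q := by abel
    rw [this]
    exact Submodule.add_mem _ h2 h1
  have le_span : (⊤ : Submodule ℤ (Fin n → ℤ)) ≤ Submodule.span ℤ (Set.range e) := by
    rw [← hspan, Submodule.span_le]
    exact hP_le
  have card_le : n ≤ Fintype.card (↥Q ⊕ Fin m) := by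
    have h1 : finrank ℤ (Submodule.span ℤ (Set.range e)) ≤ Fintype.card (↥Q ⊕ Fin m) :=
      finrank_range_le_card (R := ℤ) e
    have h2 : finrank ℤ (Submodule.span ℤ (Set.range e)) = n := by
      rw [eq_top_iff.2 le_span, finrank_top, finrank_fin_fun]
    omega
  have card_eq : Fintype.card (↥Q ⊕ Fin m) = finrank ℤ (Fin n → ℤ) := by
    rw [finrank_fin_fun]
    have : Fintype.card (↥Q ⊕ Fin m) = Q.card + m := by
      rw [Fintype.card_sum, Fintype.card_coe, Fintype.card_fin]
    rw [this] at card_le ⊢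
    omega
  let b₀ : Basis (↥Q ⊕ Fin m) ℤ (Fin n → ℤ) := basisOfTopLeSpanOfCardEqFinrank e le_span card_eq
  have hb₀ : ∀ i, b₀ i = e i := fun i => by
    simp only [b₀, coe_basisOfTopLeSpanOfCardEqFinrank]
  -- reindex by `Fin n`
  have hcardn : Fintype.card (↥Q ⊕ Fin m) = Fintype.card (Fin n) := by rw [card_eq, finrank_fin_fun, Fintype.card_fin]
  let ε : ↥Q ⊕ Fin m ≃ Fin n := Fintype.equivOfCardEq hcardn
  let b : Basis (Fin n) ℤ (Fin n → ℤ) := b₀.reindex ε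
  let I : Finset (Fin n) := Finset.univ.image fun q : ↥Q => ε (Sum.inl q)
  refine ⟨b, I, ⟨fun x => ?_⟩⟩
  -- coordinates
  have hrepr : ∀ i, b.repr x (ε i) = b₀.repr x i := fun i => by
    simp only [b, Basis.repr_reindex, Finsupp.mapDomain_equiv_apply, Equiv.symm_apply_apply]
  constructor
  · -- `x ∈ P + M` ⇒ non-negative `Q`-coordinates
    intro hx i hi
    obtain ⟨q, -, rfl⟩ := Finset.mem_image.1 hi
    rw [hrepr]
    obtain ⟨p, hp, y, hy, rfl⟩ := AddSubmonoid.mem_sup.1 hx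
    obtain ⟨c, hc⟩ := hgen p hp
    -- `p + y = Σ c q • q + (element of M)`
    set z : M := ⟨p - ∑ q ∈ Q, c q • q + y, M.add_mem hc hy⟩ with hzdef
    let g : ↥Q ⊕ Fin m → ℤ := Sum.elim (fun q => (c q : ℤ)) (fun j => fM.repr z j)
    have hxg : p + y = ∑ i, g i • b₀ i := by
      rw [Fintype.sum_sum_type]
      simp only [g, Sum.elim_inl, Sum.elim_inr, hb₀, e]
      have hz : (z : Fin n → ℤ) = ∑ j, fM.repr z j • (fM j : Fin n → ℤ) := by
        have h := congrArg (fun y : M => (y : Fin n → ℤ)) (fM.sum_repr z).symm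
        simp only [Submodule.coe_sum, Submodule.coe_smul] at h
        exact h
      have hQsum : ∑ q : ↥Q, (c q : ℤ) • (q : Fin n → ℤ) = ∑ q ∈ Q, c q • q := by
        rw [← Finset.sum_coe_sort Q]
        refine Finset.sum_congr rfl fun q _ => ?_
        rw [natCast_zsmul]
      rw [hQsum, ← hz, hzdef]
      simp only
      abel
    rw [hxg, congrFun (b₀.repr_sum_self g) (Sum.inl q)]
    simp only [g, Sum.elim_inl]
    exact Int.natCast_nonneg _
  · -- non-negative `Q`-coordinates ⇒ `x ∈ P + M`
    intro hx
    have hsum : x = ∑ i, b₀.repr x i • b₀ i := (b₀.sum_repr x).symm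
    rw [Fintype.sum_sum_type] at hsum
    have h1 : ∑ q : ↥Q, b₀.repr x (Sum.inl q) • b₀ (Sum.inl q) ∈ P := by
      refine AddSubmonoid.sum_mem _ fun q _ => ?_
      have hnn : 0 ≤ b₀.repr x (Sum.inl q) := by
        have := hx (ε (Sum.inl q)) (Finset.mem_image.2 ⟨q, Finset.mem_univ _, rfl⟩)
        rwa [hrepr] at this
      rw [hb₀]
      simp only [e, Sum.elim_inl]
      obtain ⟨k, hk⟩ := Int.eq_ofNat_of_zero_le hnn
      rw [hk, natCast_zsmul]
      exact AddSubmonoid.nsmul_mem _ (hQP _ q.2) _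
    have h2 : ∑ j : Fin m, b₀.repr x (Sum.inr j) • b₀ (Sum.inr j) ∈ M := by
      refine Submodule.sum_mem _ fun j _ => ?_
      rw [hb₀]
      simp only [e, Sum.elim_inr]
      exact Submodule.smul_mem _ _ (fM j).2
    rw [hsum]
    exact AddSubmonoid.mem_sup.2 ⟨_, h1, _, h2, rfl⟩

end Summit.ResolutionOfSingularities.ResolutionOfSingularities.Theorems.FRationalResolution.OrthantLikeOfGenerators

end
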